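import Mathlib
import HarnessLib
import Summits.Langlands.Langlands.Theses.QuarterDeficit1951
import Summits.Langlands.Langlands.Theorems.QuarterDeficit1951CorrespondentFingerprintStubLocal1951GaloisConductor
import Summits.Langlands.Langlands.Theorems.QuarterDeficit1951CorrespondentFingerprintStubLocal1951GaloisLinAlg
import Literature.NumberTheory.Automorphic.TateLocalFactors
import Literature.NumberTheory.Automorphic.AdicCompletionResidueCard
import Literature.NumberTheory.Automorphic.LocalFieldHaarBalls
import Literature.NumberTheory.Automorphic.AddCharConductorExponent
import Literature.NumberTheory.GaloisRepresentations.HeckeCharacterProofs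
import Literature.NumberTheory.GaloisRepresentations.WeilDeligneOfGalois
import Literature.NumberTheory.GaloisRepresentations.WeilDeligneOfGaloisUnramifiedProofs
import Literature.NumberTheory.GaloisRepresentations.WeilDeligneRepFrobSemisimpleProofs
import Literature.NumberTheory.GaloisRepresentations.WeilGroupFrobeniusPowers
import Literature.NumberTheory.GaloisRepresentations.DecompositionGroupOfCompletion
import Literature.NumberTheory.GaloisRepresentations.LocalGaloisGroupProofs
import Literature.NumberTheory.GaloisRepresentations.LocalGaloisGroupInertiaProofs

/-!
# Stub `stub_local1951_galois` (C1) of the crux `CorrespondentFingerprint` (stmt-Langlands-15898,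
# line `Sketch`): the Galois side at `1951`

For a framed finite-image `ρ : Γ_ℚ → GL₂(ℚ̄_ℓ)` of Artin conductor `1951`, unramified at every
`q_w ≠ 1951`, at the place `q_v = 1951`:

(i) `U¹(ℚ_v) = 1 + 𝔭` is pro-`p` in the elementwise form `x ∈ U¹ ⇒ x^{p^N} ∈ U^N`
(`pow_ringChar_pow_sub_one_mem_pow`: `y ≡ 1 (mod 𝔪) ⇒ y^{p^k} ≡ 1 (mod 𝔪^{k+1})`, read through
`‖z‖ ≤ q^{-n}` for `z ∈ 𝔪^n`);

(ii) for every Weil–Deligne representation `rv` attached to `ρ|_{W_{ℚ_v}}` by the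
Grothendieck–Deligne recipe, every transport `rℂ = ι(rv)` and every class `c` of its
Frobenius-semisimplification: `c = ⟦r'⟧` with `r'.N = 0` and `r'.ρ = ψ₁ ⊕ ψ₂` on a basis of `ℂ²`,
`ψ₁` unramified, `ψ₂` ramified with `(ψ₂|_I)^m = 1`, `p ∤ m`.  The global arithmetic (a fixed line,
non-triviality and a tame exponent `m` for `ρ(I_{𝔓₀})`, `𝔓₀ = adicCompletionPrime ℚ v`) is the landed
sub-goal `stub_local1951_galois_conductor`; it is moved to `I_{W_{ℚ_v}}` by `I_{𝔓₀} = res(I_{ℚ_v})`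
(`inertia_adicCompletionPrime_eq_map_absInertia`, `WeilGroup.inertia_map_toAbsGalois`).  Finite
inertia image forces `N = 0` in the recipe (`exp(m t(u₀) N) = ρ(u₀)^m = 1`, `t(u₀) ≠ 0`) and
`rv.ρ = ρ|_W` as matrices; the transport `rℂ` has finite-order Frobenius, hence IS
Frobenius-semisimple and equals every Frobenius-semisimplification of itself
(`IsFrobSemisimplificationOf.eq_of_eq`); the decomposition into two characters is the landed
sub-goal `stub_local1951_galois_linalg`.
[cite: SerreLocalFields1979, Ch. VI §2 and Ch. IV §2 Cor. 1] [cite: TateCorvallis1979, (4.1.3)–(4.2.1)]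
[cite: DeligneAntwerpII1973, §8.4.2]
-/

set_option linter.dupNamespace false -- project-wide option (lakefile weak.linter.dupNamespace); `Summit.Langlands.Langlands` is the mandated namespace

noncomputable section

open scoped MatrixGroups Matrix NumberField Classical NNReal
open Literature.NumberTheory.Automorphic Literature.NumberTheory.GaloisRepresentations
  IsDedekindDomain NumberField
open Literature.NumberTheory.GaloisRepresentations.IsNonarchimedeanLocalField
open Field ValuativeRel
open Summit.Langlands Rat.HeightOneSpectrum

namespace Summit.Langlands.Langlands.Theorems.CorrespondentFingerprint

section ProP

variable {F : Type*} [Field F] [ValuativeRel F] [TopologicalSpace F] [IsNonarchimedeanLocalField F]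

/-- `‖z‖_F ≤ q^{-n}` for `z ∈ 𝔪_F^n` (induction on `n`: `‖b‖ < 1 ⇒ ‖b‖ ≤ q⁻¹` by discreteness,
`normAbs_lt_zpow_iff`, and the ultrametric inequality for sums of products).
[cite: SerreLocalFields1979, Ch. II §1] -/
theorem normAbs_le_of_mem_maximalIdeal_pow (n : ℕ) {z : 𝒪[F]} (hz : z ∈ 𝓂[F] ^ n) :
    normAbs F (z : F) ≤ ((residueFieldCard F : ℝ≥0)⁻¹) ^ n := by
  induction n generalizing z with
  | zero => rw [pow_zero]; exact normAbs_le_one_iff.mpr z.2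
  | succ n ih =>
    rw [pow_succ] at hz
    refine Submodule.mul_induction_on hz (fun a ha b hb => ?_) (fun a b ha hb => ?_)
    · rw [Subring.coe_mul, map_mul, pow_succ]
      refine mul_le_mul' (ih ha) ?_
      have hb1 : normAbs F (b : F) < ((residueFieldCard F : ℝ≥0)⁻¹) ^ (0 : ℤ) := by
        rw [zpow_zero]
        exact normAbs_lt_one_iff_mem_maximalIdeal.mpr hb
      rw [LocalFieldHaar.normAbs_lt_zpow_iff, zero_add, zpow_one] at hb1
      exact hb1
    · rw [Subring.coe_add]
      exact (normAbs_add_le_max _ _).trans (max_le ha hb)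

variable (F) in
/-- **`U¹_F = 1 + 𝔭_F` is pro-`p`** (elementwise form): for `x ∈ U¹` and every `N`,
`x^{p^N} ∈ U^N` (`p` the residue characteristic), since `x ≡ 1 (mod 𝔪)` gives
`x^{p^N} ≡ 1 (mod 𝔪^{N+1})` (`pow_ringChar_pow_sub_one_mem_pow`, Serre II §4 Lemma 1).
[cite: SerreLocalFields1979, Ch. IV §2 Prop. 6 and Ch. II §4 Lemma 1] -/
theorem exists_pow_ringChar_pow_mem_unitFiltration :
    ∀ x ∈ unitFiltration F 1, ∀ N : ℕ, ∃ a : ℕ, x ^ (ringChar 𝓀[F] ^ a) ∈ unitFiltration F N := by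
  intro x hx N
  refine ⟨N, ?_⟩
  have hx1 : normAbs F (x : F) = 1 := hx.1
  have hxO : (x : F) ∈ 𝒪[F] := normAbs_le_one_iff.mp hx1.le
  have hy : (⟨(x : F), hxO⟩ : 𝒪[F]) - 1 ∈ 𝓂[F] := by
    rw [← normAbs_lt_one_iff_mem_maximalIdeal, AddSubgroupClass.coe_sub, OneMemClass.coe_one]
    refine lt_of_le_of_lt hx.2 ?_
    rw [pow_one]
    exact inv_residueFieldCard_lt_one
  have key := normAbs_le_of_mem_maximalIdeal_pow (N + 1) (pow_ringChar_pow_sub_one_mem_pow hy N)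
  rw [AddSubgroupClass.coe_sub, SubmonoidClass.coe_pow, OneMemClass.coe_one] at key
  refine ⟨by rw [Units.val_pow_eq_pow_val, map_pow, hx1, one_pow], ?_⟩
  rw [Units.val_pow_eq_pow_val]
  exact key.trans (pow_le_pow_right_of_le_one' inv_residueFieldCard_lt_one.le (Nat.le_succ N))

end ProP

/-- `ringChar 𝓀[ℚ_v] = 1951` at the place `v` with `q_v = 1951` (`#𝓀[ℚ_v] = q_v`,
`natCard_valuativeResidueField_adicCompletion_eq`, and a finite field of prime order `p` has
characteristic `p`). [folklore] -/
theorem ringChar_residueField_adicCompletion_eq {v : HeightOneSpectrum (𝓞 ℚ)}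
    (hv : v.residueCard = 1951) : ringChar 𝓀[v.adicCompletion ℚ] = 1951 := by
  have hcard : Nat.card 𝓀[v.adicCompletion ℚ] = 1951 := by
    rw [natCard_valuativeResidueField_adicCompletion_eq, hv]
  letI : Fintype 𝓀[v.adicCompletion ℚ] := Fintype.ofFinite _
  obtain ⟨n, hp, hn⟩ := FiniteField.card 𝓀[v.adicCompletion ℚ] (ringChar 𝓀[v.adicCompletion ℚ])
  rw [Nat.card_eq_fintype_card] at hcard
  have h1 : ringChar 𝓀[v.adicCompletion ℚ] ∣ 1951 := by
    rw [← hcard, hn]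
    exact dvd_pow_self _ (PNat.ne_zero n)
  exact (Nat.prime_dvd_prime_iff_eq hp (by norm_num)).mp h1

section WeilDeligne

variable {F : Type*} [Field F] [ValuativeRel F] [TopologicalSpace F] [IsNonarchimedeanLocalField F]
  {E : Type*} [Field E] [CharZero E] {n : ℕ}

/-- **Finite-exponent inertia image forces `N = 0` and `ρ_WD = ρW` in the Grothendieck–Deligne
recipe.**  If `r = (ρ_WD, N)` is attached to `ρW : W_F → GL_n(E)` (`IsWeilDeligneOfLadic`) and
`ρW(u)^m = 1` for all `u ∈ I_F` (`m ≥ 1`), then at the element `u₀ ∈ U` with `t(u₀) ≠ 1` the recipe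
reads `exp(m t(u₀) N) = ρW(u₀^m) = 1` with `m t(u₀) ≠ 0`, so `N = 0` (injectivity of `exp` on
nilpotents), and then `[ρ_WD(w)] = ρW(w)` for every `w = Φ^{-deg w} (Φ^{deg w} w)`.
[cite: DeligneAntwerpII1973, §8.4.2] [cite: TateCorvallis1979, (4.2.1)] -/
theorem IsWeilDeligneOfLadic.N_eq_zero_and_toMatrix'_eq_of_pow_eq_one
    {ρW : WeilGroup F →* GL (Fin n) E} {r : WeilDeligneRep F E (Fin n → E)}
    (h : IsWeilDeligneOfLadic ρW r) {m : ℕ} (hm : 0 < m)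
    (hρ : ∀ u ∈ WeilGroup.inertia F, ρW u ^ m = 1) :
    r.N = 0 ∧ ∀ w : WeilGroup F,
      LinearMap.toMatrix' (r.ρ w) = ((ρW w : GL (Fin n) E) : Matrix (Fin n) (Fin n) E) := by
  obtain ⟨t, U, Φ, hU, -, hΦ, ⟨u₀, hu₀U, ht₀⟩, h2, h3⟩ := h
  have hN : r.N = 0 := by
    have hNnil : IsNilpotent (LinearMap.toMatrix' r.N) :=
      r.isNilpotent_N.map LinearMap.toMatrixAlgEquiv'
    have hmem : ((u₀ ^ m : WeilGroup.inertia F) : WeilGroup F) ∈ U := by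
      rw [SubgroupClass.coe_pow]
      exact U.pow_mem hu₀U m
    have key := h2 (u₀ ^ m) hmem
    rw [SubgroupClass.coe_pow, map_pow, hρ _ u₀.2, Units.val_one, map_pow, toAdd_pow] at key
    have hne : m • (t u₀).toAdd ≠ 0 := by
      rw [nsmul_eq_mul]
      refine mul_ne_zero (by exact_mod_cast hm.ne') fun h0 => ht₀ ?_
      rw [← ofAdd_toAdd (t u₀), h0, ofAdd_zero]
    have hmat : LinearMap.toMatrix' r.N = 0 :=
      Matrix.eq_zero_of_exp_smul_eq_one hNnil hne key.symm
    exact (LinearEquiv.map_eq_zero_iff LinearMap.toMatrix').mp hmat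
  refine ⟨hN, fun w => ?_⟩
  have hmem : Φ ^ (WeilGroup.deg w) * w ∈ WeilGroup.inertia F :=
    WeilGroup.zpow_deg_mul_mem_inertia hΦ w
  have key := h3 (-WeilGroup.deg w) ⟨Φ ^ (WeilGroup.deg w) * w, hmem⟩
  have hw : Φ ^ (-WeilGroup.deg w) * (Φ ^ (WeilGroup.deg w) * w) = w := by
    rw [← mul_assoc, zpow_neg, inv_mul_cancel, one_mul]
  simp only [hw, hN, map_zero, smul_zero, neg_zero, IsNilpotent.exp_zero, mul_one] at key
  exact key

omit [CharZero E] in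
/-- `toMatrix'` is compatible with powers. [folklore] -/
theorem toMatrix'_pow (f : (Fin n → E) →ₗ[E] (Fin n → E)) (k : ℕ) :
    LinearMap.toMatrix' (f ^ k) = (LinearMap.toMatrix' f) ^ k := by
  induction k with
  | zero => rw [pow_zero, pow_zero, LinearMap.toMatrix'_one]
  | succ k ih => rw [pow_succ, pow_succ, LinearMap.toMatrix'_mul, ih]

end WeilDeligne

/-- **(C1) `stub_local1951_galois` — the Galois side at `1951`** (registered stub, verbatim).  For a
framed finite-image `ρ : Γ_ℚ → GL₂(ℚ̄_ℓ)` of Artin conductor `1951` unramified at every `q_v ≠ 1951`,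
at the place `q_v = 1951`: (i) `U¹(ℚ_v)` is pro-`p` (`exists_pow_ringChar_pow_mem_unitFiltration`);
(ii) for every Weil–Deligne representation `rv` attached to `ρ|_{W_{ℚ_v}}` by the
Grothendieck–Deligne recipe, every transport `rℂ = ι(rv)` and every class `c` of its
Frobenius-semisimplification, `c = ⟦r'⟧` for a Frobenius-semisimple `r'` with `N = 0` whose Weil
representation is `ψ₁ ⊕ ψ₂` on a basis of `ℂ²`, `ψ₁` unramified, `ψ₂` ramified and of finite order
prime to `p` on inertia (global input `stub_local1951_galois_conductor`: `a(ρ) = 1` ⇒ fixed line,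
`ρ(I) ≠ 1`, tame exponent; `N = 0` and `rv.ρ = ρ|_W` by finite inertia image; `rℂ` is already
Frobenius-semisimple; linear algebra `stub_local1951_galois_linalg`).
[cite: SerreLocalFields1979, Ch. VI §2 and Ch. IV §2 Cor. 1] [cite: TateCorvallis1979, (4.1.3)–(4.2.1)]
[cite: DeligneAntwerpII1973, §8.4.2] -/
theorem stub_local1951_galois : ∀ (ℓ : ℕ) [Fact ℓ.Prime] (ι : PadicAlgCl ℓ ≃+* ℂ)
    (ρ : FramedGaloisRep ℚ (PadicAlgCl ℓ) 2), (Set.range ρ).Finite →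
    ρ.toGaloisRep.artinConductorNat = 1951 →
    (∀ v : HeightOneSpectrum (𝓞 ℚ), v.residueCard ≠ 1951 → ρ.IsUnramifiedAt v) →
    ∀ (v : HeightOneSpectrum (𝓞 ℚ)), v.residueCard = 1951 →
    (∀ x ∈ unitFiltration (v.adicCompletion ℚ) 1, ∀ N : ℕ, ∃ a : ℕ,
        x ^ (ringChar 𝓀[v.adicCompletion ℚ] ^ a) ∈ unitFiltration (v.adicCompletion ℚ) N) ∧
    ∀ (rv : WeilDeligneRep (v.adicCompletion ℚ) (PadicAlgCl ℓ) (Fin 2 → PadicAlgCl ℓ))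
      (rℂ : WeilDeligneRep (v.adicCompletion ℚ) ℂ (Fin 2 → ℂ))
      (c : Quotient (frobSemisimpleWDSetoid (v.adicCompletion ℚ) 2)),
      IsWeilDeligneOfLadic (ρ.toLocal v).toWeilGroupHom rv →
      rv.IsTransportAlong (ι : PadicAlgCl ℓ →+* ℂ) rℂ → rℂ.HasFrobSemisimpleClass c →
      ∃ (r' : WeilDeligneRep (v.adicCompletion ℚ) ℂ (Fin 2 → ℂ)) (hr' : r'.IsFrobSemisimple),
        Quotient.mk (frobSemisimpleWDSetoid (v.adicCompletion ℚ) 2) ⟨r', hr'⟩ = c ∧ r'.N = 0 ∧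
        ∃ (ψ₁ ψ₂ : WeilGroup (v.adicCompletion ℚ) →* ℂˣ) (b : Module.Basis (Fin 2) ℂ (Fin 2 → ℂ)),
          (∀ w, r'.ρ w (b 0) = ((ψ₁ w : ℂˣ) : ℂ) • b 0) ∧
          (∀ w, r'.ρ w (b 1) = ((ψ₂ w : ℂˣ) : ℂ) • b 1) ∧
          (∀ u ∈ WeilGroup.inertia (v.adicCompletion ℚ), ψ₁ u = 1) ∧
          (∃ u ∈ WeilGroup.inertia (v.adicCompletion ℚ), ψ₂ u ≠ 1) ∧
          ∃ m : ℕ, 0 < m ∧ ¬ ringChar 𝓀[v.adicCompletion ℚ] ∣ m ∧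
            ∀ u ∈ WeilGroup.inertia (v.adicCompletion ℚ), ψ₂ u ^ m = 1 := by
  intro ℓ _ ι ρ hfin hcond hunr v hv
  refine ⟨exists_pow_ringChar_pow_mem_unitFiltration (v.adicCompletion ℚ), ?_⟩
  intro rv rℂ c hWD hTr hcl
  have hp : ringChar 𝓀[v.adicCompletion ℚ] = 1951 := ringChar_residueField_adicCompletion_eq hv
  -- the global input, moved to the inertia group of `W_{ℚ_v}`
  obtain ⟨⟨e, he0, hfix⟩, ⟨g₀, hg₀I, hg₀⟩, m, hm, hpm, hpow⟩ :=
    stub_local1951_galois_conductor ℓ ρ hfin hcond hunr v hv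
  have hρW : ∀ w : WeilGroup (v.adicCompletion ℚ), (ρ.toLocal v).toWeilGroupHom w =
      ρ (absGaloisRestrict ℚ (v.adicCompletion ℚ) (WeilGroup.toAbsGalois (v.adicCompletion ℚ) w)) :=
    fun w => rfl
  have hIW : ∀ u ∈ WeilGroup.inertia (v.adicCompletion ℚ),
      absGaloisRestrict ℚ (v.adicCompletion ℚ) (WeilGroup.toAbsGalois (v.adicCompletion ℚ) u) ∈
        (adicCompletionPrime ℚ v).inertia (absoluteGaloisGroup ℚ) := by
    intro u hu
    rw [inertia_adicCompletionPrime_eq_map_absInertia]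
    exact Subgroup.mem_map_of_mem _ (WeilGroup.mem_inertia_iff.mp hu)
  have hpowW : ∀ u ∈ WeilGroup.inertia (v.adicCompletion ℚ),
      (ρ.toLocal v).toWeilGroupHom u ^ m = 1 := fun u hu => by
    rw [hρW]; exact hpow _ (hIW u hu)
  have hfixW : ∀ u ∈ WeilGroup.inertia (v.adicCompletion ℚ),
      (((ρ.toLocal v).toWeilGroupHom u : GL (Fin 2) (PadicAlgCl ℓ)) :
        Matrix (Fin 2) (Fin 2) (PadicAlgCl ℓ)) *ᵥ e = e := fun u hu => by
    rw [hρW]; exact hfix _ (hIW u hu)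
  have hneW : ∃ u ∈ WeilGroup.inertia (v.adicCompletion ℚ), (ρ.toLocal v).toWeilGroupHom u ≠ 1 := by
    rw [inertia_adicCompletionPrime_eq_map_absInertia] at hg₀I
    obtain ⟨x, hx, rfl⟩ := hg₀I
    rw [← WeilGroup.inertia_map_toAbsGalois] at hx
    obtain ⟨u, hu, rfl⟩ := hx
    exact ⟨u, hu, hg₀⟩
  -- `N = 0`, `rv.ρ = ρ|_W`, and the transport `rℂ`
  obtain ⟨hN, hρv⟩ := IsWeilDeligneOfLadic.N_eq_zero_and_toMatrix'_eq_of_pow_eq_one hWD hm hpowW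
  have hNC : rℂ.N = 0 := hTr.N_eq_zero hN
  have hρC : ∀ w, LinearMap.toMatrix' (rℂ.ρ w) =
      (((ρ.toLocal v).toWeilGroupHom w : GL (Fin 2) (PadicAlgCl ℓ)) :
        Matrix (Fin 2) (Fin 2) (PadicAlgCl ℓ)).map (ι : PadicAlgCl ℓ →+* ℂ) := fun w => by
    rw [hTr.1 w, hρv w]
  have hρC' : ∀ w, rℂ.ρ w = Matrix.toLin' ((((ρ.toLocal v).toWeilGroupHom w : GL (Fin 2) (PadicAlgCl ℓ)) :
        Matrix (Fin 2) (Fin 2) (PadicAlgCl ℓ)).map (ι : PadicAlgCl ℓ →+* ℂ)) := fun w => by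
    rw [← hρC w, Matrix.toLin'_toMatrix']
  -- `rℂ` is Frobenius-semisimple (finite image), so it is its own Frobenius-semisimplification
  have hss : rℂ.IsFrobSemisimple := by
    intro w
    -- `ρW(w)` has finite order: two of its powers in the finite set `range ρ` coincide
    obtain ⟨i, j, hij, hij'⟩ := Set.Finite.exists_lt_map_eq_of_forall_mem
      (f := fun k : ℕ => (ρ.toLocal v).toWeilGroupHom w ^ k) (t := Set.range ρ)
      (fun k => by rw [hρW, ← map_pow]; exact ⟨_, rfl⟩) hfin
    have hk : 0 < j - i := Nat.sub_pos_of_lt hij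
    have hk1 : (ρ.toLocal v).toWeilGroupHom w ^ (j - i) = 1 := by
      rw [pow_sub _ hij.le, ← hij', mul_inv_cancel]
    refine FrobSemisimple.isSemisimple_of_pow_eq_one hk (LinearMap.toMatrix'.injective ?_)
    rw [toMatrix'_pow, hρC w, ← Matrix.map_pow, ← Units.val_pow_eq_pow_val, hk1, Units.val_one,
      Matrix.map_one _ (map_zero _) (map_one _), LinearMap.toMatrix'_one]
  obtain ⟨r'', hr'', hc⟩ := hcl
  have hr''eq : r'' = rℂ := hr''.eq_of_eq hss.isFrobSemisimplificationOf_self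
  subst hr''eq
  refine ⟨r'', hss, hc, hNC, ?_⟩
  -- the two characters, by the linear algebra sub-goal
  haveI : (WeilGroup.inertia (v.adicCompletion ℚ)).Normal :=
    WeilGroup.inertia_normal (absInertia_normal_holds (v.adicCompletion ℚ))
  have hιinj : Function.Injective (ι : PadicAlgCl ℓ →+* ℂ) := (ι : PadicAlgCl ℓ →+* ℂ).injective
  have hA : ∀ u ∈ WeilGroup.inertia (v.adicCompletion ℚ), r''.ρ u ^ m = 1 := by
    intro u hu
    apply LinearMap.toMatrix'.injective
    rw [toMatrix'_pow, hρC u, ← Matrix.map_pow, ← Units.val_pow_eq_pow_val, hpowW u hu, Units.val_one,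
      Matrix.map_one _ (map_zero _) (map_one _), LinearMap.toMatrix'_one]
  have hB : ∃ e' : Fin 2 → ℂ, e' ≠ 0 ∧ ∀ u ∈ WeilGroup.inertia (v.adicCompletion ℚ), r''.ρ u e' = e' := by
    refine ⟨(ι : PadicAlgCl ℓ →+* ℂ) ∘ e, fun h0 => he0 (funext fun i => hιinj ?_), fun u hu => ?_⟩
    · have := congrFun h0 i
      simpa using this
    · rw [hρC' u, Matrix.toLin'_apply]
      funext i
      rw [← RingHom.map_mulVec, hfixW u hu]
      rfl
  have hC : ∃ u ∈ WeilGroup.inertia (v.adicCompletion ℚ), r''.ρ u ≠ 1 := by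
    obtain ⟨u, hu, hne⟩ := hneW
    refine ⟨u, hu, fun h1 => hne ?_⟩
    have h2 := hρC u
    rw [h1, LinearMap.toMatrix'_one,
      ← Matrix.map_one (ι : PadicAlgCl ℓ →+* ℂ) (map_zero _) (map_one _)] at h2
    exact Units.ext (Matrix.map_injective hιinj h2.symm)
  obtain ⟨ψ₁, ψ₂, b, h1, h2, h3, h4, h5⟩ := stub_local1951_galois_linalg ℂ
    (WeilGroup (v.adicCompletion ℚ)) (WeilGroup.inertia (v.adicCompletion ℚ)) r''.ρ m hm hA hB hC
  exact ⟨ψ₁, ψ₂, b, h1, h2, h3, h4, m, hm, by rwa [hp], h5⟩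

end Summit.Langlands.Langlands.Theorems.CorrespondentFingerprint

end
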